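import Literature.AlgebraicGeometry.AbelianSchemes.AbelianSchemeConstSubgroupQuotient
import HarnessLib

/-!
# The exact kernel of the quotient map `ψ : A → A/K` on geometric fibre points ([MumfordAV1970] §7 Thm. 4)

Topic `AlgebraicGeometry/AbelianSchemes`; namespace `Literature.AlgebraicGeometry.AbelianSchemes.AbelianSchemeOver`.
KERNEL ONLY: theorems; no definition, no named fact, no instance, no `sorry`.  Sequel of ★
`AbelianSchemeConstSubgroupQuotient` (file (i) of the Hecke-link line, cell hodgecm-mathlib): there, for an abelian scheme
`A → S` over `S → Y` (`Y` affine) and a finite subgroup `K ⊆ A(S)` of sections acting freely by translation, the quotient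
`ψ : A → A/K` (`quotientMk`, a homomorphism for the extracted group law of `quotientBy`) is exported with «`K` is
killed» (`comp_quotientMk_eq_one`), «the kernel is killed by `m`» (`kernelKilledBy_quotientMk`) and «the fibres of `ψ`
are the `K`-orbits» (`exists_translation_apply_eq_of_quotientMk_apply_eq`).  [MumfordAV1970] §7 Thm. 4 (p. 72) states
more precisely that `K` IS the kernel: «there is a natural one-one correspondence between … finite subgroups `K ⊂ X`
and separable isogenies `f : X → Y` … `K = ker f`».  On geometric fibre points (`x : Spec Ω → A` over `s`, `Ω`
algebraically closed) this reads:

* `restrict_comp_quotientMk_eq_one` — `σ(s) ≫ ψ = 1` for `σ ∈ K`;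
* **`comp_quotientMk_eq_one_iff`** — `x ≫ ψ = 1 ↔ ∃ σ ∈ K, x = σ(s)` (⇒: `x` and the unit point have the same image,
  hence differ by a translation `t_σ`, `σ ∈ K` — ★ `IsGeometricQuotient.exists_eq_comp_aut_of_comp_eq_of_free` for the
  free affine geometric quotient `ψ`, exactly as in ★ `kernelKilledBy_quotientMk`; and `1 ≫ t_σ = σ(s)` by ★
  `comp_translation`);
* `comp_quotientMk_eq_one_iff_of_range` — the same with `K` indexed by a family of sections `τ : I → A(S)` over a set
  `K₀ ⊆ I` (`σ ∈ K ↔ ∃ c ∈ K₀, τ c = σ`): `x ≫ ψ = 1 ↔ ∃ c ∈ K₀, x = τ_c(s)` — the `hker` input shape of ★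
  `exists_hom_baseChange_forall_pointwiseHeckeQuotient` (`τ := P′.level.section_`, `K₀ = K₀(γ, r, r′)`) and, through ★
  `map_fibreHom_eq_one_iff_of_fibrePoints_range`, of ★ `exists_isSymplecticLiftable_of_fibreIsogeny_of_dualIsogeny`.

## References
* [MumfordAV1970] D. Mumford, *Abelian Varieties* (1970), §7 Thm. 4 (p. 72).
* [MumfordFogartyKirwan1994] D. Mumford, J. Fogarty, F. Kirwan, *GIT* (3rd ed.), Ch. 7 §2 Def. 7.1 (p. 129) (the points
  `σᵢ(s)` of the fibre).
HC_CM is proved only modulo the 7 printed citations until rung 0 closes; this file discharges none of them.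
-/

set_option autoImplicit false

noncomputable section

universe u

open CategoryTheory CategoryTheory.Limits AlgebraicGeometry MonoidalCategory CartesianMonoidalCategory
open scoped MonObj

namespace Literature.AlgebraicGeometry.AbelianSchemes

namespace AbelianSchemeOver

open Literature.AlgebraicGeometry.RelativeSpec

variable {S : Scheme.{u}} (A : AbelianSchemeOver S)
  {Y : Scheme.{u}} (u : S ⟶ Y) (K : Subgroup A.Sections) [Finite K] [Y.IsSeparated]
  [IsSeparated (A.X.hom ≫ u)] [S.IsSeparated]
  (hcov : ∀ x : A.left, ∃ O : (A.translationActionOver u K).StableAffineOpens, x ∈ O.1)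
  [LocallyOfFiniteType (A.X.hom ≫ u)] [IsLocallyNoetherian Y]
  (hG : ∃ _ : GrpObj (A.quotientOver u K), IsMonHom (A.quotientMk u K hcov))
  (hsm : Smooth (A.quotientOver u K).hom) (hgc : GeometricallyConnected (A.quotientOver u K).hom)

/-- **`σ(s) ≫ ψ = 1` for `σ ∈ K`**: the restriction of a section of `K` to any fibre is killed by the quotient map
(★ `comp_quotientMk_eq_one`). [cite: MumfordAV1970, §7 Thm. 4 (p. 72)] -/
theorem restrict_comp_quotientMk_eq_one {Ω : Type u} [Field Ω] (s : Spec (.of Ω) ⟶ S) (σ : K) :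
    letI : GrpObj (A.quotientOver u K) := (A.quotientBy u K hcov hG hsm hgc).grpObj
    A.restrict s (σ : A.Sections) ≫ A.quotientMk u K hcov = 1 := by
  letI : GrpObj (A.quotientOver u K) := (A.quotientBy u K hcov hG hsm hgc).grpObj
  change (toUnit (Over.mk s) ≫ (σ : A.Sections)) ≫ A.quotientMk u K hcov = 1
  rw [Category.assoc, A.comp_quotientMk_eq_one u K hcov hG hsm hgc σ, MonObj.comp_one]

/-- **THE KERNEL OF `ψ : A → A/K` ON GEOMETRIC FIBRE POINTS IS EXACTLY `K`**: for `Ω` algebraically closed and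
`x : Spec Ω → A` over `s`, `x ≫ ψ = 1 ↔ x = σ(s)` for some `σ ∈ K` (Mumford: «`K = ker f`»; ⇒ by the orbit description of
the fibres of the free geometric quotient, ★ `IsGeometricQuotient.exists_eq_comp_aut_of_comp_eq_of_free`, ⇐ by ★
`comp_quotientMk_eq_one`). [cite: MumfordAV1970, §7 Thm. 4 (p. 72)] -/
theorem comp_quotientMk_eq_one_iff [IsAffine Y]
    (hfree : ∀ (Ω : Type u) [Field Ω] [IsAlgClosed Ω] (x : Spec (.of Ω) ⟶ A.left) (σ : K), σ ≠ 1 →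
      x ≫ (A.translation (σ : A.Sections)).left ≠ x)
    ⦃Ω : Type u⦄ [Field Ω] [IsAlgClosed Ω] (s : Spec (.of Ω) ⟶ S) (x : A.FibrePoints s) :
    letI : GrpObj (A.quotientOver u K) := (A.quotientBy u K hcov hG hsm hgc).grpObj
    x ≫ A.quotientMk u K hcov = 1 ↔ ∃ σ : K, x = A.restrict s (σ : A.Sections) := by
  letI : GrpObj (A.quotientOver u K) := (A.quotientBy u K hcov hG hsm hgc).grpObj
  haveI := A.isMonHom_quotientMk u K hcov hG hsm hgc
  haveI := A.isAffineHom_quotientMk_left u K hcov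
  haveI : Fintype K := Fintype.ofFinite K
  constructor
  · intro hx
    have h1 : (1 : A.FibrePoints s) ≫ A.quotientMk u K hcov = 1 := MonObj.one_comp _
    have h2 : (1 : A.FibrePoints s).left ≫ (A.quotientMk u K hcov).left = x.left ≫ (A.quotientMk u K hcov).left := by
      rw [← Over.comp_left, ← Over.comp_left, h1, hx]
    obtain ⟨σ, hσ⟩ := (A.isGeometricQuotient_quotientActionOver u K hcov).exists_eq_comp_aut_of_comp_eq_of_free
      (A.quotientActionOver_free u K hcov hfree) _ _ h2
    have h3 : x = (1 : A.FibrePoints s) ≫ A.translation (σ : A.Sections) :=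
      Over.OverMorphism.ext (by rw [Over.comp_left]; exact hσ)
    refine ⟨σ, ?_⟩
    rw [h3, comp_translation, mul_one]
  · rintro ⟨σ, rfl⟩
    exact A.restrict_comp_quotientMk_eq_one u K hcov hG hsm hgc s σ

/-- **The exact kernel, indexed form**: if `K` is the set of sections `τ c`, `c ∈ K₀`, then
`x ≫ ψ = 1 ↔ ∃ c ∈ K₀, x = τ_c(s)` — the `hker` shape of the Hecke-link assemblers (`τ := level.section_`, Mumford's
`Σ aᵢσᵢ(s)`). [cite: MumfordAV1970, §7 Thm. 4 (p. 72)] [cite: MumfordFogartyKirwan1994, Ch. 7 §2 Definition 7.1 (p. 129)] -/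
theorem comp_quotientMk_eq_one_iff_of_range [IsAffine Y]
    (hfree : ∀ (Ω : Type u) [Field Ω] [IsAlgClosed Ω] (x : Spec (.of Ω) ⟶ A.left) (σ : K), σ ≠ 1 →
      x ≫ (A.translation (σ : A.Sections)).left ≠ x)
    {I : Type*} (K₀ : Set I) (τ : I → A.Sections) (hK : ∀ σ : A.Sections, σ ∈ K ↔ ∃ c ∈ K₀, τ c = σ)
    ⦃Ω : Type u⦄ [Field Ω] [IsAlgClosed Ω] (s : Spec (.of Ω) ⟶ S) (x : A.FibrePoints s) :
    letI : GrpObj (A.quotientOver u K) := (A.quotientBy u K hcov hG hsm hgc).grpObj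
    x ≫ A.quotientMk u K hcov = 1 ↔ ∃ c ∈ K₀, x = A.restrict s (τ c) := by
  letI : GrpObj (A.quotientOver u K) := (A.quotientBy u K hcov hG hsm hgc).grpObj
  rw [A.comp_quotientMk_eq_one_iff u K hcov hG hsm hgc hfree s x]
  constructor
  · rintro ⟨σ, rfl⟩
    obtain ⟨c, hc, hcσ⟩ := (hK σ).1 σ.2
    exact ⟨c, hc, by rw [hcσ]⟩
  · rintro ⟨c, hc, rfl⟩
    exact ⟨⟨τ c, (hK (τ c)).2 ⟨c, hc, rfl⟩⟩, rfl⟩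

end AbelianSchemeOver

end Literature.AlgebraicGeometry.AbelianSchemes

end
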